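import Mathlib
import Summits.Ventures.PercRepro2.Defs
import Summits.Ventures.PercRepro2.Harris
import Summits.Ventures.PercRepro2.Graph
import Summits.Ventures.PercRepro2.Events
import Summits.Ventures.PercRepro2.TReduction
import Summits.Ventures.PercRepro2.TReductionBase
import Summits.Ventures.PercRepro2.KTwoFiveNegative
import Summits.Ventures.PercRepro2.THBaseEnum
import Summits.Ventures.PercRepro2.THClassVEnum
import Summits.Ventures.PercRepro2.THKTwoFiveEnum

/-!
# Slice B of the base-case census of `K_{2,5}`: edge `r x₀` open (mine-a g50)

The pinning patterns with `s0 = 1` (the edge `r x₀` open, i.e. contracted), split by the state of `x₀ h`.  Every lemma is a kernel evaluation (`decide +kernel`) of `THKTwoFive.enum` over all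
patterns of the remaining edges: the antipodal base case of `K_{2,5}` at the pair
`({x₀, x₁ ∈ T}, {x₂, x₃, x₄ ∈ T})` is nonnegative at every proper pinning in this slice.
Together (`THKTwoFive.enum_nonneg`) the slices cover every pattern other than «every edge free».
No instance, no notation.
-/

namespace Summit.Ventures.PercRepro2

namespace THKTwoFive

set_option maxHeartbeats 0 in
/-- `r x₀` open, `x₀ h` in state `0`: `4^8` leaves. -/
lemma slice_1_0 : ∀ s2 s3 s4 s5 s6 s7 s8 s9 : Fin 3, 0 ≤ enum 1 0 s2 s3 s4 s5 s6 s7 s8 s9 := by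
  decide +kernel

set_option maxHeartbeats 0 in
/-- `r x₀` open, `x₀ h` in state `1`: `4^8` leaves. -/
lemma slice_1_1 : ∀ s2 s3 s4 s5 s6 s7 s8 s9 : Fin 3, 0 ≤ enum 1 1 s2 s3 s4 s5 s6 s7 s8 s9 := by
  decide +kernel

set_option maxHeartbeats 0 in
/-- `r x₀` open, `x₀ h` in state `2`: `2 · 4^8` leaves. -/
lemma slice_1_2 : ∀ s2 s3 s4 s5 s6 s7 s8 s9 : Fin 3, 0 ≤ enum 1 2 s2 s3 s4 s5 s6 s7 s8 s9 := by
  decide +kernel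


end THKTwoFive

end Summit.Ventures.PercRepro2
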